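import Summits.ValiantsHypothesis.ValiantsHypothesis.Theorems.BarrierLeverAnchoredDoorHitsLowerPairsStarHybrid
import Summits.ValiantsHypothesis.ValiantsHypothesis.Theorems.BarrierLeverAnchoredDoorHitsLowerPairsStarRigid

/-!
# Route BarrierLever — support item `AnchoredDoorHitsLowerPairs` (stmt-ValiantsHypothesis-22510), line `anchored_peeling`:
# CONJECTURE HC — STAR-LOWER BY HYBRID LABELLING (node texts offered under D-0145, val-np-p1 g33)

BY-NAME NARROWINGS of the door slot of record `Stmt.conjStarLower` (…StarDoor) through the HYBRID LABELLING CERTIFICATE (…StarHybrid,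
p748450, `StarDoor.starDet_ne_zero_of_hybrid[_swap]`): an injective lower pair `(u, w)` is hit as soon as SOME column labelling `B` (faces of
the row side) and SOME numeric row-side weights `dh` make the explicit complex matrix `(StarDoor.hybTop B dh (u i) (w j))` nonsingular (or
the mirror data `W`, `gh` do).

* `Stmt.conjStarHybrid` (CONJECTURE HC): every injective lower pair carries a hybrid labelling certificate in one of the two orientations.
  `conjStarLower_of_conjStarHybrid`, `anchoredDoorHitsLowerPairs_of_conjStarHybrid`.
* `Stmt.conjStarHybridRigid`: the same restricted to VERTEX–FACE-RIGID pairs (`StarDoor.IsFaceRigid`, …StarRigid p743876); with the face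
  pivot reduction `conjStarLower_of_conjStarRigid` this weaker node still closes the door slot: `conjStarLower_of_conjStarHybridRigid`,
  `anchoredDoorHitsLowerPairs_of_conjStarHybridRigid`.

CENSUS OF RECORD (kit j336349, evidence on 22510; HOME/val-np-p1/g33): a hybrid certificate was found BY LOCAL SEARCH IN MILLISECONDS, IN
BOTH ORIENTATIONS, for every pair tested — all 1 798 ordered lower pairs on 5+5 vertices, all 121 on 4+5, all 40 on 4+4, 200 random pairs on
5–7 × 5–7 vertices (r ≤ 44), the parity pair (K_{1,4}, C₄⊔pt), the degree accident (K₅, K_{1,6}⊔2K₂), the K_{2,6}-circuit pair, (2^{[4]}, B(5,2)),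
the rigid family (K_{1,4m−2}⊔K₂, m·C₄) for m = 2, 3, 4 — zero failures. (The PURE labelling certificate of …StarLabelling, `dh = 0`, exists for
1 764/1 798 at 5+5 and fails exactly on Vandermonde-type pairs; the evaluation certificates, `B = ∅`, fail on the parity accidents; HC needs both
halves.) WHY IT MIGHT FAIL: an injective lower pair on which `det hybTop(B, dh)` vanishes identically in `dh` for EVERY column labelling `B` and
the same for the mirror data. READING: in the polynomial picture the hybrid matrix is a HERMITE-type interpolation matrix at the subset-sum
nodes `q_A = Σ_{b ∈ A} dh_b` (the labels prescribe which row blocks hang rigidly on which column vertices); HC says such a scheme is always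
unisolvent for some choice of blocks. Nothing here proves `Stmt.conjStarLower`; nothing bears on crux 14610 or on `VP ≠ VNP`.
-/

set_option linter.dupNamespace false

namespace Summit.ValiantsHypothesis.ValiantsHypothesis.Theorems.BarrierLever.AnchoredPeeling

open Finset

noncomputable section

namespace StarDoor

variable {h : ℕ}

/-- **Hybrid labelling certificate (either orientation).** The pair `(u, w)` is HYBRID-CERTIFIED if some column labels `B` with numeric
row-side weights `dh` give a nonsingular `hybTop` matrix, or some row labels `W` with numeric column-side weights `gh` give a nonsingular
mirror matrix. Decidable per instance by one complex (in practice small-integer) determinant. -/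
def IsHybridCert {r : ℕ} (u w : Fin r → Finset (Fin h)) : Prop :=
  (∃ (B : Fin h → Finset (Fin h)) (dh : Fin h → Fin h → ℂ), (Matrix.of fun i j : Fin r => hybTop B dh (u i) (w j)).det ≠ 0) ∨
  (∃ (W : Fin h → Finset (Fin h)) (gh : Fin h → Fin h → ℂ), (Matrix.of fun i j : Fin r => hybTop W (fun e b => gh b e) (w j) (u i)).det ≠ 0)

/-- A hybrid certificate gives a nonsingular star-forest block (no lower-set or injectivity hypothesis). -/
theorem starDet_ne_zero_of_isHybridCert {r : ℕ} {u w : Fin r → Finset (Fin h)} (hc : IsHybridCert u w) :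
    ∃ g d : Fin h → Fin h → ℂ, (Matrix.of fun i j : Fin r => starEntry g d (u i) (w j)).det ≠ 0 := by
  rcases hc with ⟨B, dh, hN⟩ | ⟨W, gh, hN⟩
  · exact starDet_ne_zero_of_hybrid u w B dh hN
  · exact starDet_ne_zero_of_hybrid_swap u w W gh hN

end StarDoor

/-- **NODE TEXT (offered, D-0145): CONJECTURE HC — every injective LOWER pair is hybrid-certified.** For all `h`, `r` and every pair of injective
enumerations `u`, `w` of lower families of faces, some column labelling with numeric row weights (or the mirror data) makes the hybrid top matrix
nonsingular. Census-clean (kit j336349: every pair on ≤ 5+5 vertices in BOTH orientations, 200 random larger pairs, all named pairs of the line). -/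
def Stmt.conjStarHybrid : Prop :=
  ∀ (h r : ℕ) (u w : Fin r → Finset (Fin h)), Function.Injective u → Function.Injective w →
    IsLowerSet (Set.range u) → IsLowerSet (Set.range w) → StarDoor.IsHybridCert u w

/-- **NODE TEXT (offered, D-0145): HC ON VERTEX–FACE-RIGID PAIRS** — the weaker node that still closes the door slot (rigid pairs are the only ones
the face pivot cannot reduce, …StarRigid). -/
def Stmt.conjStarHybridRigid : Prop :=
  ∀ (h r : ℕ) (u w : Fin r → Finset (Fin h)), Function.Injective u → Function.Injective w →
    IsLowerSet (Set.range u) → IsLowerSet (Set.range w) → StarDoor.IsFaceRigid u w → StarDoor.IsHybridCert u w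

/-- **HC ⟹ STAR-LOWER** (kernel arrow through `StarDoor.starDet_ne_zero_of_hybrid[_swap]`). -/
theorem conjStarLower_of_conjStarHybrid (H : Stmt.conjStarHybrid) : Stmt.conjStarLower :=
  fun h r u w hu hw hlu hlw => StarDoor.starDet_ne_zero_of_isHybridCert (H h r u w hu hw hlu hlw)

/-- HC is implied by its rigid restriction only through STAR-LOWER; directly: **HC on rigid pairs ⟹ STAR-LOWER on rigid pairs.** -/
theorem conjStarRigid_of_conjStarHybridRigid (H : Stmt.conjStarHybridRigid) : Stmt.conjStarRigid :=
  fun h r u w hu hw hlu hlw hrig => StarDoor.starDet_ne_zero_of_isHybridCert (H h r u w hu hw hlu hlw hrig)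

/-- **HC on rigid pairs ⟹ STAR-LOWER** (face-pivot reduction of …StarRigid). -/
theorem conjStarLower_of_conjStarHybridRigid (H : Stmt.conjStarHybridRigid) : Stmt.conjStarLower :=
  conjStarLower_of_conjStarRigid (conjStarRigid_of_conjStarHybridRigid H)

/-- **COMPOSITION BY NAME: `Stmt.conjStarHybrid → AnchoredDoorHitsLowerPairs`.** -/
theorem anchoredDoorHitsLowerPairs_of_conjStarHybrid (H : Stmt.conjStarHybrid) :
    Summit.ValiantsHypothesis.ValiantsHypothesis.Theses.BarrierLever.AnchoredDoorHitsLowerPairs :=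
  anchoredDoorHitsLowerPairs_of_conjStarLower (conjStarLower_of_conjStarHybrid H)

/-- **COMPOSITION BY NAME: `Stmt.conjStarHybridRigid → AnchoredDoorHitsLowerPairs`.** -/
theorem anchoredDoorHitsLowerPairs_of_conjStarHybridRigid (H : Stmt.conjStarHybridRigid) :
    Summit.ValiantsHypothesis.ValiantsHypothesis.Theses.BarrierLever.AnchoredDoorHitsLowerPairs :=
  anchoredDoorHitsLowerPairs_of_conjStarLower (conjStarLower_of_conjStarHybridRigid H)

end

end Summit.ValiantsHypothesis.ValiantsHypothesis.Theorems.BarrierLever.AnchoredPeeling
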